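import Summits.QuantumFields.BalabanUV.T4Continuum.Support.AveragingDeficitCovGrad
import Summits.QuantumFields.BalabanUV.T4Continuum.Support.SpreadLift
import Summits.QuantumFields.BalabanUV.T4Continuum.Support.AveragingDeficitTwoLevelPrep
import HarnessLib

/-!
# AveragingDeficitBlockDensity (T⁴ programme, node NE3, row NE3-R2, gen 6) — THE COVARIANT BLOCK DENSITY `S₀` of a coarse
# direction field and the UNIFORM LOOP LEMMA `‖U(loop) − 1‖ ≤ |loop|²·a` (file 2 of (γ2), the gradient-bounded one-step lift —
# record `t4/T4-EST-NE3-R2.md` v0.6 §4)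

HONEST FRAMING (cell `pub-balaban`, T4-DAG PAGE 1; unit `b2b-balaban-t4-ne3r2-p1` = owner of BINDER-OWNERS row NE3-R2, gen 6).
The cell's T4 target is the finite-torus continuum limit of the unit-scale averaged loop expectations — NOT infinite volume, NO
mass gap, NOT Clay, NOT summit progress.  WHY.  The curl-paired residual of the NE3 energy route in the weighted currency
(GAPS G-ne7king10-1 REPAIR) needs a right inverse `S` of the linearised average `pushDir L U` whose covariant GRADIENT is
controlled by the coarse covariant gradient of the datum ((γ2), v0.6 §4: `S = S₀ − spreadInverse ∘ (pushDir ∘ S₀ − Id)`).  THIS FILE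
builds the first summand `S₀`, the COVARIANT BLOCK-CONSTANT DENSITY: on every fine bond `⟨x, x + e_μ⟩` of the block of the coarse
site `y = ⌊x/L⌋` the value `L⁻¹·φ(y, μ)`, parallel-transported from the coarse frame at `L(y + e_μ)` to the fine frame at `x + e_μ`
along the straight contour `Γ_c` of the coarse bond `c = (y, μ)` (backwards) and then along the block TREE `Γ_{Ly, x+e_μ}` of (42)
(`blockDensity`), so that the linearised frames of `BlockAveragePushDirSplit.frameLin` read it EXACTLY (file 4).  All [folklore],
0 sorry: §1 THE UNIFORM LOOP LEMMA — for a `U(N)`-valued `U` in `SmallField U a` and ANY closed word `Γ` at any base point,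
**`‖U(Γ) − 1‖ ≤ |Γ|²·a`** (`norm_hol_closed_sub_one_le`: axial gauge at the base point, the tree's `axial_bond_bound` «p. 24–25» on
every bond of the word, this row's `norm_hol_sub_one_le_of_bonds`), and the transport-discrepancy bound
`‖Ad_A X − Ad_B X‖ ≤ 2‖B⁻¹A − 1‖·‖X‖`; §2 `btree`, `bseg`, **`blockDensity`** with its pointwise norm `= L⁻¹‖φ(⌊x/L⌋, μ)‖`,
`𝔲(N)`-valuedness and `(L·M)`-periodicity for `(L·M)`-periodic `U` and `M`-periodic `φ`; §3 block geometry of one lattice step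
(`cdiv_add_e_of_lt` / `cdiv_add_e_of_eq`, `l1_cmod_le`); §4 the period sums `Σ_{[0,LM)^d}‖S₀φ‖² = L^{d−2}·Σ_{[0,M)^d}‖φ‖²` and
`Σ‖S₀φ‖ = L^{d−1}·Σ‖φ‖`.  NE3 ITSELF IS NOT PROVED; nothing of Bałaban's is asserted (context: [Balaban1985Averaging] (42) p. 23,
p. 24–25; [Balaban1985Variational] (75)–(77) p. 289).  ABSOLUTE RULE kept: no printed sentence is a hypothesis.  PLACEMENT:
`Summits/QuantumFields/BalabanUV/`; imports this row's `AveragingDeficitCovGrad` ∕ `AveragingDeficitTwoLevelPrep` and leaf-01's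
`SpreadLift`; moves nothing.
-/

set_option autoImplicit false

open scoped BigOperators Matrix Matrix.Norms.L2Operator
open NormedSpace Finset

namespace Summit.QuantumFields.BalabanUV.T4Continuum.AveragingDeficitBlockDensity

open Literature.MathematicalPhysics.QuantumFieldTheory.Balaban1983to89
open B7Prop1Explicit B7Prop2Explicit MatrixLog UnitaryModel
open T4AveragingDeficitWall hiding Site Plane Plaq Bond
open T4AveragingDeficitWallBoundary (IsPeriodicCfg periodBox blockSites_periodBox sum_blocks_eq)
open T4AveragingDeficitNonAbelian (Ad_mul Ad_sub)
open AveragingDeficitPeriodicCounting (IsPeriodicDir)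
open AveragingDeficitTransport (norm_Ad_of_unitary mem_U1_of_unitary Ad_mem_skewAdjoint)
open AveragingDeficitNearIdentity (Ad_one norm_Ad_sub_le Ad_real_smul)
open AveragingDeficitLocality (bondsOf l1_le_of_mem_bondsOf)
open AveragingDeficitLiftPeriodic (hol_shift)
open AveragingDeficitTwoLevelPrep (mem_U1_of_isUnitaryCfg)
open SpreadLiftDirection (isUnitaryCfg_gaugeAct')
open SpreadLiftWords (cdiv_smul_add_boxVec cmod_smul_add_boxVec)
open SkeletonLattice (cdiv cmod smul_cdiv_add_cmod cmod_nonneg cmod_lt cdiv_eq_of_repr cdiv_add_period)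

noncomputable section

variable {d : ℕ} {n : Type*} [Fintype n] [DecidableEq n]

/-! ## §1 The uniform loop lemma and transport discrepancies -/

/-- **THE UNIFORM LOOP LEMMA**: for `U(N)`-valued `U` with every plaquette variable within `a` of `1`, the holonomy of ANY
closed lattice word `Γ` (from any base point) satisfies `‖U(Γ) − 1‖ ≤ |Γ|²·a` (axial gauge at the base point: every bond of
the word is within `ℓ¹`-distance `|Γ|` of the base, hence within `|Γ|·a` of `1`; telescoping). [cite: Balaban1985Averaging, p.24–25] -/
theorem norm_hol_closed_sub_one_le [Nonempty n] {U : Site d → Fin d → (Matrix n n ℂ)ˣ} (hU : IsUnitaryCfg U) {a : ℝ} (ha : 0 ≤ a)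
    (hUa : SmallField U a) (q : Site d) (w : List (Letter d)) (hw : disp w = 0) :
    ‖((hol U q w : (Matrix n n ℂ)ˣ) : Matrix n n ℂ) - 1‖ ≤ (w.length : ℝ) ^ 2 * a := by
  have hU1 : ∀ x κ, U x κ ∈ U1 (Matrix n n ℂ) := fun x κ => mem_U1_of_unitary (hU x κ)
  set u : Site d → (Matrix n n ℂ)ˣ := axialFn U q with hu
  set U₀ : Site d → Fin d → (Matrix n n ℂ)ˣ := gaugeAct u U with hU₀
  have huU : ∀ x, u x ∈ unitaryUnits (Matrix n n ℂ) := fun x => hol_mem_of hU _ _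
  have hU₀u : IsUnitaryCfg U₀ := isUnitaryCfg_gaugeAct' huU hU
  have h1 : hol U q w = hol U₀ q w := by
    rw [hU₀, hol_gaugeAct_closed _ _ _ _ hw]
    have : u q = 1 := by rw [hu, axialFn, sub_self, treeWord_zero, hol_nil]
    rw [this, inv_one, one_mul, mul_one]
  have h3 : ∀ b ∈ bondsOf q w, ‖((U₀ b.1 b.2 : (Matrix n n ℂ)ˣ) : Matrix n n ℂ) - 1‖ ≤ w.length * a := by
    intro b hb
    have h := axial_bond_bound U hU1 q hUa ha b.1 b.2
    refine h.trans (mul_le_mul_of_nonneg_right ?_ ha)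
    exact_mod_cast l1_le_of_mem_bondsOf q w b hb
  have h4 := AveragingDeficitNearIdentity.norm_hol_sub_one_le_of_bonds hU₀u q w h3
  rw [h1]
  refine h4.trans (le_of_eq ?_)
  ring

/-- **TRANSPORT DISCREPANCY**: `‖Ad_A X − Ad_B X‖ ≤ 2·‖B⁻¹A − 1‖·‖X‖` for unitary `A`, `B`. [folklore] -/
theorem norm_Ad_sub_Ad_le [Nonempty n] {A B : (Matrix n n ℂ)ˣ} (hA : A ∈ unitaryUnits (Matrix n n ℂ)) (hB : B ∈ unitaryUnits (Matrix n n ℂ)) (X : Matrix n n ℂ) :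
    ‖Ad A X - Ad B X‖ ≤ 2 * ‖((B⁻¹ * A : (Matrix n n ℂ)ˣ) : Matrix n n ℂ) - 1‖ * ‖X‖ := by
  have e1 : Ad A X - Ad B X = Ad B (Ad (B⁻¹ * A) X - X) := by
    rw [Ad_sub, ← Ad_mul, ← mul_assoc, mul_inv_cancel, one_mul]
  rw [e1, norm_Ad_of_unitary hB]
  exact norm_Ad_sub_le ((unitaryUnits (Matrix n n ℂ)).mul_mem ((unitaryUnits (Matrix n n ℂ)).inv_mem hB) hA) X

/-- `‖Ad_A X − Ad_B X‖ ≤ 2t·‖X‖` once `‖B⁻¹A − 1‖ ≤ t`. [folklore] -/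
theorem norm_Ad_sub_Ad_le_of_le [Nonempty n] {A B : (Matrix n n ℂ)ˣ} (hA : A ∈ unitaryUnits (Matrix n n ℂ)) (hB : B ∈ unitaryUnits (Matrix n n ℂ)) (X : Matrix n n ℂ)
    {t : ℝ} (ht : ‖((B⁻¹ * A : (Matrix n n ℂ)ˣ) : Matrix n n ℂ) - 1‖ ≤ t) : ‖Ad A X - Ad B X‖ ≤ 2 * t * ‖X‖ := by
  refine (norm_Ad_sub_Ad_le hA hB X).trans ?_
  gcongr

/-! ## §2 The covariant block density -/

/-- The tree transport of the block of `y`: `U(Γ_{Ly, z})` along the tree contour of (42) from the block corner `Ly` to `z`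
(= `axialFn U (L•y) z`). [cite: Balaban1985Averaging, p.24] -/
def btree (L : ℕ) (U : Site d → Fin d → (Matrix n n ℂ)ˣ) (y z : Site d) : (Matrix n n ℂ)ˣ := hol U ((L : ℤ) • y) (treeWord (z - (L : ℤ) • y))

/-- The straight transport of the coarse bond `c = (y, μ)`: `U(Γ_c) = U(Ly, μ)U(Ly + e_μ, μ)⋯U(Ly + (L−1)e_μ, μ)`.
[cite: Balaban1985Averaging, p.20] -/
def bseg (L : ℕ) (U : Site d → Fin d → (Matrix n n ℂ)ˣ) (y : Site d) (μ : Fin d) : (Matrix n n ℂ)ˣ := hol U ((L : ℤ) • y) (seg μ L)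

/-- **THE COVARIANT BLOCK DENSITY `S₀`**: `(S₀φ)(x, μ) = L⁻¹ · Ad_{U(Γ_{Ly,x+e_μ})⁻¹ U(Γ_{(y,μ)})} φ(y, μ)`, `y = ⌊x/L⌋` — the coarse
value spread with density `1/L` over the block, transported to the fine frame at `x + e_μ`. [folklore] -/
def blockDensity (L : ℕ) (U : Site d → Fin d → (Matrix n n ℂ)ˣ) (φ : Site d → Fin d → Matrix n n ℂ) : Site d → Fin d → Matrix n n ℂ :=
  fun x μ => ((L : ℝ)⁻¹) • Ad ((btree L U (cdiv L x) (x + e μ))⁻¹ * bseg L U (cdiv L x) μ) (φ (cdiv L x) μ)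

/-- `btree = axialFn` at the block corner. [folklore] -/
theorem btree_eq_axialFn (L : ℕ) (U : Site d → Fin d → (Matrix n n ℂ)ˣ) (y z : Site d) : btree L U y z = axialFn U ((L : ℤ) • y) z := rfl

/-- `bseg y μ = U(Γ_c)` and `cavg L U y μ = e^{X_c}·U(Γ_c)`. [cite: Balaban1985Averaging, (42) p.23] -/
theorem cavg_eq_expUnit_mul_bseg (L : ℕ) (U : Site d → Fin d → (Matrix n n ℂ)ˣ) (y : Site d) (μ : Fin d) :
    AveragingDeficitChartCalculus.cavg L U y μ = expUnit (Xavg L U ((L : ℤ) • y) μ) * bseg L U y μ := rfl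

/-- The transports are unitary on `U(N)` data. [folklore] -/
theorem btree_mem {U : Site d → Fin d → (Matrix n n ℂ)ˣ} (hU : IsUnitaryCfg U) (L : ℕ) (y z : Site d) :
    btree L U y z ∈ unitaryUnits (Matrix n n ℂ) := hol_mem_of hU _ _

/-- The transports are unitary on `U(N)` data. [folklore] -/
theorem bseg_mem {U : Site d → Fin d → (Matrix n n ℂ)ˣ} (hU : IsUnitaryCfg U) (L : ℕ) (y : Site d) (μ : Fin d) :
    bseg L U y μ ∈ unitaryUnits (Matrix n n ℂ) := hol_mem_of hU _ _

/-- The combined transport of `blockDensity` is unitary. [folklore] -/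
theorem transport_mem {U : Site d → Fin d → (Matrix n n ℂ)ˣ} (hU : IsUnitaryCfg U) (L : ℕ) (y z : Site d) (μ : Fin d) :
    (btree L U y z)⁻¹ * bseg L U y μ ∈ unitaryUnits (Matrix n n ℂ) :=
  (unitaryUnits (Matrix n n ℂ)).mul_mem ((unitaryUnits (Matrix n n ℂ)).inv_mem (btree_mem hU L y z)) (bseg_mem hU L y μ)

/-- `blockDensity` unfolds. [folklore] -/
theorem blockDensity_apply (L : ℕ) (U : Site d → Fin d → (Matrix n n ℂ)ˣ) (φ : Site d → Fin d → Matrix n n ℂ) (x : Site d) (μ : Fin d) :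
    blockDensity L U φ x μ
      = ((L : ℝ)⁻¹) • Ad ((btree L U (cdiv L x) (x + e μ))⁻¹ * bseg L U (cdiv L x) μ) (φ (cdiv L x) μ) := rfl

/-- **POINTWISE NORM**: `‖(S₀φ)(x, μ)‖ = L⁻¹·‖φ(⌊x/L⌋, μ)‖` on `U(N)` data. [folklore] -/
theorem norm_blockDensity {U : Site d → Fin d → (Matrix n n ℂ)ˣ} (hU : IsUnitaryCfg U) (L : ℕ) (φ : Site d → Fin d → Matrix n n ℂ) (x : Site d)
    (μ : Fin d) : ‖blockDensity L U φ x μ‖ = (L : ℝ)⁻¹ * ‖φ (cdiv L x) μ‖ := by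
  rw [blockDensity_apply, norm_smul, norm_inv, Real.norm_natCast, norm_Ad_of_unitary (transport_mem hU L _ _ μ)]

/-- `blockDensity` is additive in the datum. [folklore] -/
theorem blockDensity_add (L : ℕ) (U : Site d → Fin d → (Matrix n n ℂ)ˣ) (φ φ' : Site d → Fin d → Matrix n n ℂ) :
    blockDensity L U (φ + φ') = blockDensity L U φ + blockDensity L U φ' := by
  funext x μ
  simp only [blockDensity_apply, Pi.add_apply, AveragingDeficitNearIdentity.Ad_add, smul_add]

/-- `blockDensity` is real-homogeneous in the datum. [folklore] -/
theorem blockDensity_smul (L : ℕ) (U : Site d → Fin d → (Matrix n n ℂ)ˣ) (c : ℝ) (φ : Site d → Fin d → Matrix n n ℂ) :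
    blockDensity L U (c • φ) = c • blockDensity L U φ := by
  funext x μ
  simp only [blockDensity_apply, Pi.smul_apply, Ad_real_smul, smul_comm c]

/-- `blockDensity` is subtractive in the datum. [folklore] -/
theorem blockDensity_sub (L : ℕ) (U : Site d → Fin d → (Matrix n n ℂ)ˣ) (φ φ' : Site d → Fin d → Matrix n n ℂ) :
    blockDensity L U (φ - φ') = blockDensity L U φ - blockDensity L U φ' := by
  rw [sub_eq_add_neg, blockDensity_add, ← neg_one_smul ℝ φ', blockDensity_smul, neg_one_smul, ← sub_eq_add_neg]

/-- `𝔲(N)` data give a `𝔲(N)` direction. [folklore] -/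
theorem isSkewDir_blockDensity {U : Site d → Fin d → (Matrix n n ℂ)ˣ} (hU : IsUnitaryCfg U) (L : ℕ) {φ : Site d → Fin d → Matrix n n ℂ}
    (hφ : ∀ y κ, φ y κ ∈ skewAdjoint (Matrix n n ℂ)) : IsSkewDir (blockDensity L U φ) := fun x μ => by
  rw [blockDensity_apply]
  exact skewAdjoint.smul_mem _ (Ad_mem_skewAdjoint (transport_mem hU L _ _ μ) (hφ _ _))

/-- The block transports of translated blocks coincide for `L·M e_j`-invariant `U`. [folklore] -/
theorem btree_add_period (L : ℕ) {U : Site d → Fin d → (Matrix n n ℂ)ˣ} {M : ℕ} (hUP : IsPeriodicCfg U ((L : ℤ) * M)) (y z : Site d)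
    (j : Fin d) : btree L U (y + (M : ℤ) • e j) (z + ((L : ℤ) * M) • e j) = btree L U y z := by
  have hUv : ∀ (x : Site d) (μ : Fin d), U (x + ((L : ℤ) * M) • e j) μ = U x μ := fun x μ => hUP x j μ
  unfold btree
  rw [show (L : ℤ) • (y + (M : ℤ) • e j) = (L : ℤ) • y + ((L : ℤ) * M) • e j by rw [smul_add, smul_smul],
    show z + ((L : ℤ) * M) • e j - ((L : ℤ) • y + ((L : ℤ) * M) • e j) = z - (L : ℤ) • y by abel]
  exact hol_shift (W := U) (W' := U) hUv _ _

/-- The straight transports of translated coarse bonds coincide for `L·M e_j`-invariant `U`. [folklore] -/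
theorem bseg_add_period (L : ℕ) {U : Site d → Fin d → (Matrix n n ℂ)ˣ} {M : ℕ} (hUP : IsPeriodicCfg U ((L : ℤ) * M)) (y : Site d)
    (μ j : Fin d) : bseg L U (y + (M : ℤ) • e j) μ = bseg L U y μ := by
  have hUv : ∀ (x : Site d) (ν : Fin d), U (x + ((L : ℤ) * M) • e j) ν = U x ν := fun x ν => hUP x j ν
  unfold bseg
  rw [show (L : ℤ) • (y + (M : ℤ) • e j) = (L : ℤ) • y + ((L : ℤ) * M) • e j by rw [smul_add, smul_smul]]
  exact hol_shift (W := U) (W' := U) hUv _ _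

/-- **PERIODICITY**: for `U` of period `L·M` and coarse data of period `M`, `S₀φ` has period `L·M`. [folklore] -/
theorem isPeriodicDir_blockDensity {L : ℕ} (hL : 1 ≤ L) {U : Site d → Fin d → (Matrix n n ℂ)ˣ} {M : ℕ}
    (hUP : IsPeriodicCfg U ((L : ℤ) * M)) {φ : Site d → Fin d → Matrix n n ℂ} (hφ : IsPeriodicDir φ (M : ℤ)) :
    IsPeriodicDir (blockDensity L U φ) ((L : ℤ) * M) := by
  intro x j μ
  rw [blockDensity_apply, blockDensity_apply, cdiv_add_period hL (M : ℤ) x j, hφ _ j μ,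
    show x + ((L : ℤ) * M) • e j + e μ = x + e μ + ((L : ℤ) * M) • e j by abel, btree_add_period L hUP,
    bseg_add_period L hUP]

/-! ## §3 Block geometry of one lattice step -/

omit [Fintype n] [DecidableEq n] in
/-- `|offset|₁ ≤ d·L` for the in-block offset of any point. [folklore] -/
theorem l1_cmod_le {L : ℕ} (hL : 1 ≤ L) (x : Site d) : l1 (cmod L x) ≤ d * L := by
  unfold l1
  calc ∑ κ, (cmod L x κ).natAbs ≤ ∑ _κ : Fin d, L := Finset.sum_le_sum fun κ _ => by
          have h0 := cmod_nonneg hL x κ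
          have h1 := cmod_lt hL x κ
          omega
    _ = d * L := by simp

omit [Fintype n] [DecidableEq n] in
/-- The offset from the block corner is the in-block offset: `x − L⌊x/L⌋ = x mod L`. [folklore] -/
theorem sub_corner_eq_cmod (L : ℕ) (x : Site d) : x - (L : ℤ) • cdiv L x = cmod L x := by
  have h := smul_cdiv_add_cmod L x
  rw [sub_eq_iff_eq_add, add_comm, h]

omit [Fintype n] [DecidableEq n] in
/-- `|x − L⌊x/L⌋|₁ ≤ d·L`. [folklore] -/
theorem l1_sub_corner_le {L : ℕ} (hL : 1 ≤ L) (x : Site d) : l1 (x - (L : ℤ) • cdiv L x) ≤ d * L := by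
  rw [sub_corner_eq_cmod]; exact l1_cmod_le hL x

omit [Fintype n] [DecidableEq n] in
/-- `|x + v − L⌊x/L⌋|₁ ≤ d·L + |v|₁`. [folklore] -/
theorem l1_add_sub_corner_le {L : ℕ} (hL : 1 ≤ L) (x v : Site d) : l1 (x + v - (L : ℤ) • cdiv L x) ≤ d * L + l1 v := by
  have h := l1_add_le (x - (L : ℤ) • cdiv L x) v
  rw [show x - (L : ℤ) • cdiv L x + v = x + v - (L : ℤ) • cdiv L x by abel] at h
  have h2 := l1_sub_corner_le hL x
  omega

omit [Fintype n] [DecidableEq n] in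
/-- `|e_μ|₁ = 1`. [folklore] -/
theorem l1_e (μ : Fin d) : l1 (e μ : Site d) = 1 := by
  have h := l1_zsmul_e (d := d) 1 μ
  rwa [one_smul] at h

omit [Fintype n] [DecidableEq n] in
/-- A step in direction `μ` that stays in the block: `⌊(x + e_μ)/L⌋ = ⌊x/L⌋` when `(x mod L)_μ + 1 < L`. [folklore] -/
theorem cdiv_add_e_of_lt {L : ℕ} (hL : 1 ≤ L) (x : Site d) (μ : Fin d) (h : cmod L x μ + 1 < L) :
    cdiv L (x + e μ) = cdiv L x := by
  refine cdiv_eq_of_repr (L := L) (q := cmod L x + e μ) ?_ ?_ ?_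
  · rw [← add_assoc, smul_cdiv_add_cmod]
  · intro i
    have h0 := cmod_nonneg hL x i
    simp only [Pi.add_apply, e_apply]
    split_ifs <;> omega
  · intro i
    have h1 := cmod_lt hL x i
    simp only [Pi.add_apply, e_apply]
    split_ifs with hi
    · subst hi; omega
    · omega

omit [Fintype n] [DecidableEq n] in
/-- A step in direction `μ` that leaves the block: `⌊(x + e_μ)/L⌋ = ⌊x/L⌋ + e_μ` when `(x mod L)_μ + 1 = L`. [folklore] -/
theorem cdiv_add_e_of_eq {L : ℕ} (hL : 1 ≤ L) (x : Site d) (μ : Fin d) (h : cmod L x μ + 1 = L) :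
    cdiv L (x + e μ) = cdiv L x + e μ := by
  refine cdiv_eq_of_repr (L := L) (q := cmod L x + e μ - (L : ℤ) • e μ) ?_ ?_ ?_
  · rw [smul_add, show (L : ℤ) • cdiv L x + (L : ℤ) • e μ + (cmod L x + e μ - (L : ℤ) • e μ)
      = ((L : ℤ) • cdiv L x + cmod L x) + e μ by abel, smul_cdiv_add_cmod]
  · intro i
    have h0 := cmod_nonneg hL x i
    simp only [Pi.add_apply, Pi.sub_apply, Pi.smul_apply, e_apply, smul_eq_mul]
    split_ifs with hi
    · subst hi; omega
    · omega
  · intro i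
    have h1 := cmod_lt hL x i
    simp only [Pi.add_apply, Pi.sub_apply, Pi.smul_apply, e_apply, smul_eq_mul]
    split_ifs with hi
    · subst hi
      have : (1 : ℤ) ≤ L := by exact_mod_cast hL
      omega
    · omega

omit [Fintype n] [DecidableEq n] in
/-- The two cases exhaust: `(x mod L)_μ + 1 < L` or `= L`. [folklore] -/
theorem cmod_succ_lt_or_eq {L : ℕ} (hL : 1 ≤ L) (x : Site d) (μ : Fin d) : cmod L x μ + 1 < L ∨ cmod L x μ + 1 = L := by
  have h1 := cmod_lt hL x μ
  omega

/-! ## §4 Period sums of the block density -/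

omit [Fintype n] [DecidableEq n] in
/-- Sums over the fine period box, block by block, of a function of `(⌊x/L⌋, x)`. [folklore] -/
theorem sum_periodBox_blocks {L : ℕ} (hL : 1 ≤ L) (M : ℕ) (g : Site d → Site d → ℝ) :
    ∑ x ∈ periodBox (L * M), g (cdiv L x) x
      = ∑ y ∈ periodBox M, ∑ r : Fin d → Fin L, g y ((L : ℤ) • y + boxVec L r) := by
  rw [← blockSites_periodBox L M hL, ← sum_blocks_eq L hL (periodBox M) (fun x => g (cdiv L x) x)]
  refine Finset.sum_congr rfl fun y _ => Finset.sum_congr rfl fun r _ => ?_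
  rw [cdiv_smul_add_boxVec]

omit [Fintype n] [DecidableEq n] in
/-- `#[0,L)^d = L^d` as a real number. [folklore] -/
theorem card_offsets_real (L : ℕ) : ((Finset.univ : Finset (Fin d → Fin L)).card : ℝ) = (L : ℝ) ^ d := by
  rw [Finset.card_univ, Fintype.card_fun, Fintype.card_fin, Fintype.card_fin]; push_cast; ring

/-- **`ℓ²` OVER ONE PERIOD**: `Σ_{x∈[0,LM)^d, μ} ‖(S₀φ)(x,μ)‖² = L^d/L² · Σ_{y∈[0,M)^d, μ} ‖φ(y,μ)‖²`. [folklore] -/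
theorem dirSq_blockDensity {U : Site d → Fin d → (Matrix n n ℂ)ˣ} (hU : IsUnitaryCfg U) {L : ℕ} (hL : 1 ≤ L) (φ : Site d → Fin d → Matrix n n ℂ)
    (M : ℕ) : dirSq (blockDensity L U φ) (periodBox (L * M)) = (L : ℝ) ^ d / (L : ℝ) ^ 2 * dirSq φ (periodBox M) := by
  unfold dirSq
  have h := sum_periodBox_blocks hL M (fun y _ => ∑ κ : Fin d, ((L : ℝ)⁻¹ * ‖φ y κ‖) ^ 2)
  simp only [norm_blockDensity hU] at h ⊢
  rw [h, Finset.mul_sum]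
  refine Finset.sum_congr rfl fun y _ => ?_
  rw [Finset.sum_const, nsmul_eq_mul, card_offsets_real, Finset.mul_sum, Finset.mul_sum]
  refine Finset.sum_congr rfl fun κ _ => ?_
  have hL0 : (L : ℝ) ≠ 0 := by exact_mod_cast (by omega : L ≠ 0)
  field_simp

/-- **`ℓ¹` OVER ONE PERIOD**: `Σ_{x∈[0,LM)^d, μ} ‖(S₀φ)(x,μ)‖ = L^d/L · Σ_{y∈[0,M)^d, μ} ‖φ(y,μ)‖`. [folklore] -/
theorem dirL1_blockDensity {U : Site d → Fin d → (Matrix n n ℂ)ˣ} (hU : IsUnitaryCfg U) {L : ℕ} (hL : 1 ≤ L) (φ : Site d → Fin d → Matrix n n ℂ)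
    (M : ℕ) : dirL1 (blockDensity L U φ) (periodBox (L * M)) = (L : ℝ) ^ d / (L : ℝ) * dirL1 φ (periodBox M) := by
  unfold dirL1
  have h := sum_periodBox_blocks hL M (fun y _ => ∑ κ : Fin d, (L : ℝ)⁻¹ * ‖φ y κ‖)
  simp only [norm_blockDensity hU] at h ⊢
  rw [h, Finset.mul_sum]
  refine Finset.sum_congr rfl fun y _ => ?_
  rw [Finset.sum_const, nsmul_eq_mul, card_offsets_real, Finset.mul_sum, Finset.mul_sum]
  refine Finset.sum_congr rfl fun κ _ => ?_
  have hL0 : (L : ℝ) ≠ 0 := by exact_mod_cast (by omega : L ≠ 0)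
  field_simp

/-! ## §5 The exponential factor of the average is near `1`: `cavg = e^{X_c}·bseg`, `‖e^{X_c} − 1‖ ≤ 4·loopRad` -/

/-- `‖e^X − 1‖ ≤ 2‖X‖` for `‖X‖ ≤ 1`. [folklore] -/
theorem norm_exp_sub_one_le_two_mul {X : Matrix n n ℂ} (hX : ‖X‖ ≤ 1) : ‖exp X - (1 : Matrix n n ℂ)‖ ≤ 2 * ‖X‖ := by
  have h1 := (norm_exp_sub_one_le_of_norm_le (le_refl ‖X‖)).1
  have h2 := Real.abs_exp_sub_one_sub_id_le (x := ‖X‖) (by rw [abs_of_nonneg (norm_nonneg _)]; exact hX)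
  have h3 := (abs_le.mp h2).2
  nlinarith [norm_nonneg X]

section Small

variable [Nonempty n] {L : ℕ} (hL : 1 ≤ L) {U : Site d → Fin d → (Matrix n n ℂ)ˣ} (hU : IsUnitaryCfg U) {a : ℝ} (ha : 0 ≤ a)
  (h512 : 512 * (d + 1) * (d + 4) * (L : ℝ) ^ 2 * a ≤ 1) (hUa : SmallField U a)

include hL hU ha h512 hUa

/-- `‖X_c‖ ≤ 2·loopRad` under the standard smallness (`norm_Xavg_le` + `loopBound_of_smallField`). [cite: Balaban1985Averaging, p.25] -/
theorem norm_Xavg_le_loopRad (y : Site d) (μ : Fin d) :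
    ‖Xavg L U ((L : ℤ) • y) μ‖ ≤ 2 * SpreadLift.loopRad d L a := by
  have hw := SpreadLift.loopRad_le (d := d) h512
  exact AveragingDeficitSideDeriv.norm_Xavg_le L hL U _ μ (hw.trans (by norm_num))
    (SpreadLift.loopBound_of_smallField hL hU ha h512 hUa y μ)

/-- **`‖e^{X_c} − 1‖ ≤ 4·loopRad`**. [folklore] -/
theorem norm_expUnit_Xavg_sub_one_le (y : Site d) (μ : Fin d) :
    ‖((expUnit (Xavg L U ((L : ℤ) • y) μ) : (Matrix n n ℂ)ˣ) : Matrix n n ℂ) - 1‖ ≤ 4 * SpreadLift.loopRad d L a := by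
  have hX := norm_Xavg_le_loopRad hL hU ha h512 hUa y μ
  have hw := SpreadLift.loopRad_le (d := d) h512
  have h1 : ‖Xavg L U ((L : ℤ) • y) μ‖ ≤ 1 := by linarith
  rw [val_expUnit]
  linarith [norm_exp_sub_one_le_two_mul h1]

/-- The averaged bond is unitary under the standard smallness (tree `cavg_isUnitaryCfg`). [folklore] -/
theorem cavg_mem (y : Site d) (μ : Fin d) : AveragingDeficitChartCalculus.cavg L U y μ ∈ unitaryUnits (Matrix n n ℂ) :=
  AveragingDeficitTwoLevelPrep.cavg_isUnitaryCfg hL hU ha h512 hUa y μ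

/-- `e^{X_c}` is unitary under the standard smallness. [folklore] -/
theorem expUnit_Xavg_mem (y : Site d) (μ : Fin d) : expUnit (Xavg L U ((L : ℤ) • y) μ) ∈ unitaryUnits (Matrix n n ℂ) := by
  have h : expUnit (Xavg L U ((L : ℤ) • y) μ) = AveragingDeficitChartCalculus.cavg L U y μ * (bseg L U y μ)⁻¹ := by
    rw [cavg_eq_expUnit_mul_bseg, mul_inv_cancel_right]
  rw [h]
  exact (unitaryUnits (Matrix n n ℂ)).mul_mem (cavg_mem hL hU ha h512 hUa y μ) ((unitaryUnits (Matrix n n ℂ)).inv_mem (bseg_mem hU L y μ))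

/-- **`‖U(Γ_c)⁻¹ · V̄(c) − 1‖ ≤ 4·loopRad`**: the averaged bond against the straight transport. [folklore] -/
theorem norm_bseg_inv_cavg_sub_one_le (y : Site d) (μ : Fin d) :
    ‖(((bseg L U y μ)⁻¹ * AveragingDeficitChartCalculus.cavg L U y μ : (Matrix n n ℂ)ˣ) : Matrix n n ℂ) - 1‖ ≤ 4 * SpreadLift.loopRad d L a := by
  have hB := bseg_mem hU L y μ
  have hBi := (unitaryUnits (Matrix n n ℂ)).inv_mem hB
  rw [cavg_eq_expUnit_mul_bseg]
  -- `B⁻¹ (E B) − 1 = B⁻¹ (E − 1) B`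
  have e1 : (((bseg L U y μ)⁻¹ * (expUnit (Xavg L U ((L : ℤ) • y) μ) * bseg L U y μ) : (Matrix n n ℂ)ˣ) : Matrix n n ℂ) - 1
      = (((bseg L U y μ)⁻¹ : (Matrix n n ℂ)ˣ) : Matrix n n ℂ) * ((((expUnit (Xavg L U ((L : ℤ) • y) μ)) : (Matrix n n ℂ)ˣ) : Matrix n n ℂ) - 1) * ((bseg L U y μ : (Matrix n n ℂ)ˣ) : Matrix n n ℂ) := by
    rw [mul_sub, sub_mul, mul_one, Units.inv_mul, Units.val_mul, Units.val_mul, mul_assoc]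
  rw [e1]
  have hU1 : (((bseg L U y μ)⁻¹ : (Matrix n n ℂ)ˣ) : Matrix n n ℂ) ∈ unitary (Matrix n n ℂ) := mem_unitaryUnits.mp hBi
  have hU2 : ((bseg L U y μ : (Matrix n n ℂ)ˣ) : Matrix n n ℂ) ∈ unitary (Matrix n n ℂ) := mem_unitaryUnits.mp hB
  rw [CStarRing.norm_mul_mem_unitary _ hU2, CStarRing.norm_mem_unitary_mul _ hU1]
  exact norm_expUnit_Xavg_sub_one_le hL hU ha h512 hUa y μ

/-- … and `‖V̄(c)⁻¹ · U(Γ_c) − 1‖ ≤ 4·loopRad`. [folklore] -/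
theorem norm_cavg_inv_bseg_sub_one_le (y : Site d) (μ : Fin d) :
    ‖(((AveragingDeficitChartCalculus.cavg L U y μ)⁻¹ * bseg L U y μ : (Matrix n n ℂ)ˣ) : Matrix n n ℂ) - 1‖ ≤ 4 * SpreadLift.loopRad d L a := by
  have h := norm_bseg_inv_cavg_sub_one_le hL hU ha h512 hUa y μ
  have hW : (bseg L U y μ)⁻¹ * AveragingDeficitChartCalculus.cavg L U y μ ∈ unitaryUnits (Matrix n n ℂ) :=
    (unitaryUnits (Matrix n n ℂ)).mul_mem ((unitaryUnits (Matrix n n ℂ)).inv_mem (bseg_mem hU L y μ)) (cavg_mem hL hU ha h512 hUa y μ)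
  have e : (AveragingDeficitChartCalculus.cavg L U y μ)⁻¹ * bseg L U y μ
      = ((bseg L U y μ)⁻¹ * AveragingDeficitChartCalculus.cavg L U y μ)⁻¹ := by rw [mul_inv_rev, inv_inv]
  rw [e]
  exact (norm_inv_sub_one_le (mem_U1_of_unitary hW)).trans h

end Small

omit [Fintype n] [DecidableEq n] in
/-- `4·loopRad = 64(d+1)(d+4)L²a`, spelled out. [folklore] -/
theorem four_loopRad_eq (L : ℕ) (a : ℝ) :
    4 * SpreadLift.loopRad d L a = 64 * ((d : ℝ) + 1) * ((d : ℝ) + 4) * (L : ℝ) ^ 2 * a := by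
  unfold SpreadLift.loopRad; ring

end

end Summit.QuantumFields.BalabanUV.T4Continuum.AveragingDeficitBlockDensity
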